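import Summits.BirchSwinnertonDyer.BirchSwinnertonDyer.Theorems.ResidualThetaTransportAtTwoThetaTransportResidualCount
import Summits.BirchSwinnertonDyer.BirchSwinnertonDyer.Theorems.ResidualThetaTransportAtTwoThetaTransportResidualIso
import Summits.BirchSwinnertonDyer.BirchSwinnertonDyer.Theorems.ResidualThetaTransportAtTwoThetaTransportIntegralSchurAtTwo
import Summits.BirchSwinnertonDyer.BirchSwinnertonDyer.Theorems.ResidualThetaTransportAtTwoThetaTransportThetaIndependence
import Summits.BirchSwinnertonDyer.BirchSwinnertonDyer.Theorems.ResidualThetaTransportAtTwoLambdaLowerBoundOEulerFactorFrobeniusAtTwo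
import Summits.BirchSwinnertonDyer.BirchSwinnertonDyer.Theorems.TwoAdicConverseEulerFactorAtTwo
import Literature.NumberTheory.EllipticCurves.MazurRubin2015.KummerImageGoodReduction
import Literature.NumberTheory.EllipticCurves.Kato2004.LocalIwasawaCohomology

/-!
# Sketch (sidea k2·g14) — TYPED DICTIONARY «Abhishek–Jha–Shekhar 2025, *2-Selmer companion modular forms*
# (Ann. Math. Québec; arXiv:2506.23805) ↦ tree», for the stub `stub_cmLambdaLower` = RSL_g (stmt-22608) of
# crux (R≥)ᵖ `ResidualThetaCountLowerPureAtTwo` (stmt-26074), route RTT.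

HONEST FRAMING: this file proves NO arithmetic; it (§1) `#check`s, by fully-qualified name, the landed tree
declarations that are the tree side of each dictionary row of the card `Ideas/stub-cmlambdalower-k2-g14.md`
(so every row is a NAME that elaborates, not prose), and (§2) records as two one-line kernel facts the reason the
one p-CONGRUENCE local-condition theorem the tree holds in print form (Mazur–Rubin 2015 Thm 3.1 (iv)(b)) is VOID
at `p = 2` — its binders are `p ≠ 2` and `e(v|p) < p − 1`.  BSD is not proved by any of this; nothing here is a
route, a registry write, or a proposal.
-/

namespace Summit.BirchSwinnertonDyer.BirchSwinnertonDyer.Cruxes.ResidualThetaCountLowerPureAtTwo.SideaK2G14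

/-! ## §1 The dictionary rows, tree side (each `#check` = the row's declaration exists with this name) -/

section Dictionary
open Summit.BirchSwinnertonDyer.BirchSwinnertonDyer.Theorems

-- Row D1 (AJS §0 «φ : A_{f₁}[π] ≅ A_{f₂}[π]», Rem. 5 lattice choice) ↦ the residual isomorphism
-- `((W[2^∞])[2])^f ≅ A_g[ϖ]` (LANDED, p634266):
#check @ThetaTransport.residualIso

-- Row D2 (AJS Thm (mainthm): «S_Gr(A_{f₁}[π]/K) ≅ S_Gr(A_{f₂}[π]/K)», prime-by-prime local comparison +
-- «residual Selmer = Selmer of the residual module») ↦ the Θ-plus ϖ-Selmer COUNT companionship over `ℚ_∞`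
-- `#Sel⁺_{S₀}(ℚ_∞, A_g)[ϖ] = (#R⁺_{S₀}(W[2]/ℚ_∞))^f` (LANDED `stub_transport`, p641162):
#check @ThetaTransport.transport_count
#check @ThetaTransport.ncard_eq_ncard_pow_of_transport

-- Row D3 (AJS Rem. 4: «for 𝔭 ∣ 2 the local condition … seems difficult to determine in terms of the residual
-- Galois representation at 2»; AJS Lemma 3 = ordinary filtration) ↦ the INTEGRAL transport at `2` along a
-- `D₂`-equivariant `Θ : A_g ≃+ W[2^∞]^n`, Θ-independent by integral Schur (LANDED p637233 / p639306):
#check @ThetaTransport.transportedKummer_iff_of_decomp_equivariant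
#check @ThetaTransport.setOf_transportedKummer_eq_of_decomp_equivariant

-- Row D4 (AJS Lemma 2: at `v ∤ Np` the unramified Kummer image is determined by `A[π]`; their error terms at
-- `v ∣ N`) ↦ the `S₀`-IMPRIMITIVE bookkeeping: level primes and bad primes of `W` are RELAXED places, and the
-- good places of `S₀` are charged the Greenberg–Vatsal Euler-factor λ, COMPUTED in the kernel:
#check @LambdaLowerBoundO.free_finrank_quotient_span_eulerQuadratic_frobenius_two
#check @TwoAdicTwistConverse.valuation_frobeniusExponent_two_eq

-- Row D5 (AJS work at the bottom layer `K`; RSL_g works along the cyclotomic tower) ↦ the local Iwasawa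
-- cohomology carrier at every finite place (pinned interface, existence + uniqueness PROVED):
#check @Literature.NumberTheory.EllipticCurves.Kato2004.LocalIwasawaH1Data

-- Row D6 (the ONE printed p-congruence local-condition theorem at a GOOD place above p held by the tree:
-- Mazur–Rubin 2015 Thm 3.1 (iv)(b), binders `p ≠ 2`, `e(v|p) < p − 1` — VOID at `p = 2`, see §2):
#check @Literature.NumberTheory.EllipticCurves.MazurRubin2015.selmerLocalKer_iff_of_goodReduction_above

end Dictionary

/-! ## §2 Why Row D6 cannot be cited at `p = 2` (the card's trap T-MR15), as kernel one-liners -/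

/-- Mazur–Rubin 2015 Thm 3.1 (iv)(b) needs the ramification index `e = e(v|p)` of a place above `p` to satisfy
`e < p − 1`; at `p = 2` no place qualifies (`e ≥ 1`). -/
theorem mazurRubin_ramification_hyp_void_at_two (e : ℕ) (he : 1 ≤ e) : ¬ e < 2 - 1 := by
  omega

/-- … and the tree's transcription carries the binder `p ≠ 2` literally, so at the route's prime the named
fact has no instance: any `h : p ≠ 2` with `p = 2` is absurd. -/
theorem mazurRubin_prime_hyp_void_at_two {p : ℕ} (hp : p = 2) (h : p ≠ 2) : False :=
  h hp

end Summit.BirchSwinnertonDyer.BirchSwinnertonDyer.Cruxes.ResidualThetaCountLowerPureAtTwo.SideaK2G14
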